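import Literature.NumberTheory.FaltingsSerre.ParamodularTemplate
import HarnessLib

/-!
# The Faltings–Serre method after Brumer–Pacetti–Poor–Tornaría–Voight–Yuen, VIII:
# the instance `N = 353` (certificate `certs/353/certificate.canonical.json`, sha256 `f9c58454c0fee809…`)

[BPPTVY] = A. Brumer, A. Pacetti, C. Poor, G. Tornaría, J. Voight, D. S. Yuen, *On the paramodularity of
typical abelian surfaces*, Algebra & Number Theory **13**:5 (2019) 1145–1195 [cite: BrumerEtAl2019];
the conclusion of this file is their PUBLISHED Theorem 7.2.1 (p. 1189, printed numbering: the Jacobian of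
`C₃₅₃ : y² + (x³+x+1)y = x²`, LMFDB `353.a.353.1`, is paramodular of level `353`, residual image
`S₃ ≀ C₂`).  [PY15] = C. Poor, D. S. Yuen, *Paramodular cusp forms*, Math. Comp. **84** (2015) 1401–1438
(the level-353 nonlift eigenform `f₃₅₃`) [cite: PoorYuen2015].  [PSY] = C. Poor, J. Shurman, D. S. Yuen,
*Nonlift weight two paramodular eigenform constructions*, J. Korean Math. Soc. 57 (2020) (the formula
`f₃₅₃ = Q/L` in Gritsenko lifts of theta blocks, file `QL-353.txt` of the authors' website).

This file is the `N = 353` INSTANCE of the template `paramodular_of_surfaceCertificate`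
(`ParamodularTemplate.lean`), in exactly the shape of `Paramodular349.lean`: `A = Jac(C₃₅₃)` is
paramodular of level `353` away from `353`, GIVEN (i) the cited Faltings–Serre criterion `hFS`
([BPPTVY, Thm 2.1.5]; discharged in `CriterionProofs.lean` by `traceEq_of_faltingsSerre_symplectic_holds`),
(ii) the Arthur-dependent input `hρf` ([BPPTVY, Thm 4.3.4]), and (iii) the CERTIFICATE `Certificate353` =
`SurfaceCertificate 353 checkPrimes353`, a hypothesis discharged OUTSIDE THE KERNEL by the cell's merged
certificate `certs/353/certificate.canonical.json`
(sha256 `f9c58454c0fee8091a6b9e1fefbb18ffc9cb091db6d4d5113f028da54859e767`), every load-bearing datum by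
two independent implementations.  It is an independent machine RE-CERTIFICATION of [BPPTVY, Thm 7.2.1]:
own check-prime set `P(353) = {3,5,7,11,13,19,37,41,97,137}` (a subset of the printed fifteen primes),
own residual sieve, every Hecke eigenvalue recomputed twice; no new mathematics is proved here.
-/

noncomputable section

namespace Literature.NumberTheory.FaltingsSerre.Paramodular353

open Polynomial IsDedekindDomain
open Literature.NumberTheory.FaltingsSerre Literature.NumberTheory.GaloisRepresentations
  Literature.NumberTheory.Automorphic.Paramodular Literature.NumberTheory.Automorphic
  Literature.AlgebraicGeometry.Motives
open scoped NumberField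

/-- The check primes `P(353)` of the engineer-1 (gen 3) certificate: finest-invariant obstruction search
on the class-field data of BPPTVY's degree-18 field `K₀` (`65535` quadratic extensions, `20` extension
groups of `S₃ ≀ C₂`; two independent implementations, four identical runs), complete with nothing
undetermined: `{3,5,7,11,13,19,37,41,97,137}` — a subset of the printed
`{3,5,7,11,13,19,23,29,31,37,41,43,53,97,137}`. [cite: BrumerEtAl2019, Alg 2.4.1 p. 1156 (the algorithm producing such a set); Thm 7.2.1 p. 1189 (printed set)] -/
def checkPrimes353 : Finset ℕ := {3, 5, 7, 11, 13, 19, 37, 41, 97, 137}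

/-- Data check: ten check primes, `137` the largest, `17`, `23` and `43` absent. [folklore] -/
theorem checkPrimes353_card : checkPrimes353.card = 10 ∧ 137 ∈ checkPrimes353 ∧ 17 ∉ checkPrimes353 ∧
    23 ∉ checkPrimes353 ∧ 43 ∉ checkPrimes353 := by
  simp [checkPrimes353]

/-- **The `N = 353` certificate, as a hypothesis**: `SurfaceCertificate 353 checkPrimes353 J ν ρA ρf`
(`ParamodularTemplate.lean`; fields `similitude₁₂`, `det_isUnit`, `transpose_eq`, `diag_eq`,
`unramified₁₂`, `absIrreducible`, `residual_eq`, `complete`, `traces` of `Certificate`).  Discharged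
OUTSIDE THE KERNEL by `certs/353/certificate.canonical.json` (sha256 `f9c58454c0fee8091a6b9e1fefbb18ffc9cb091db6d4d5113f028da54859e767`) — blocks:
`residual` (image `S₃ ≀ C₂`: `ℚ(A[2])` = splitting field of the 2-division sextic, LMFDB `6.0.22592.1`;
`ρ̄_f ≃ ρ̄_A` by the engineer-1 sieve with `Q₅(f₃₅₃) ≡ 1+T+T³+T⁴`, `Q₁₁(f₃₅₃) ≡ 1+T²+T⁴ (mod 2)`, each
coefficient by two recomputations (`λ_p` by restriction on two code bases, `b_p` by `T₁(p²)` on two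
engines), and independently by Route E (étale-algebra sieve on `λ₅`, `λ₁₁` parities only); candidate fields
from the LMFDB — completeness CITED), `classfield`/`group_theory`/`obstructing` (`K₀` degree 18,
`Cl_S(K₀) = 1` GRH-free twice, `65535` extensions, check primes = `checkPrimes353`), `trace_check`
(`a_p(A₃₅₃) = a_p(f₃₅₃)` on `checkPrimes353`: `−2,1,0,2,−1,−6,5,6,−11,−9`, each side by two implementations). [cite: BrumerEtAl2019, Alg 2.4.1 p. 1156; Thm 2.1.5 p. 1150; Thm 7.2.1 p. 1189] -/
def Certificate353 (J : Matrix (Fin 4) (Fin 4) ℤ_[2]) (ν : Field.absoluteGaloisGroup ℚ → ℤ_[2])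
    (ρA ρf : FramedGaloisRep ℚ ℤ_[2] 4) : Prop :=
  SurfaceCertificate 353 checkPrimes353 J ν ρA ρf

/-- **`A₃₅₃` is paramodular of level `353` away from `353`, from the certificate** ([BPPTVY, Thm 7.2.1],
re-certified).  Binders exactly as in `paramodular_of_surfaceCertificate` with `N = 353`,
`T = checkPrimes353`; `h2` is the hand check `L_2(A,T) = Q_2(f,T)` (`a_2 = −1`, `b_2 = 3` both sides). [cite: BrumerEtAl2019, Thm 7.2.1 p. 1189; Thm 2.1.5 p. 1150; Thm 4.3.4 p. 1169; Alg 2.4.1 p. 1156] -/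
theorem paramodular_353 (hFS : traceEq_of_faltingsSerre_symplectic)
    {A : AbelianVariety ℚ} {f : Matrix (Fin 2) (Fin 2) ℂ → ℂ}
    {ρA ρf : FramedGaloisRep ℚ ℤ_[2] 4} {J : Matrix (Fin 4) (Fin 4) ℤ_[2]}
    {ν : Field.absoluteGaloisGroup ℚ → ℤ_[2]}
    {b : Module.Basis (Fin 4) ℚ_[2] (A.rationalTateModule 2)}
    (hC : Certificate353 J ν ρA ρf)
    (hframe : A.IsFrameOfTateRep 2 b (rationalize ρA))
    (aA bA af bf : ℕ → ℤ)
    (hA : ∀ p : ℕ, p.Prime → ¬ p ∣ 353 →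
      A.HasGoodEulerFactorAt p ((lPolynomialOfSurface p (aA p) (bA p)).map (Int.castRingHom ℚ)))
    (hρf : ∀ p : ℕ, p.Prime → ¬ p ∣ 353 → p ≠ 2 →
      ∀ v : HeightOneSpectrum (𝓞 ℚ), ((p : ℕ) : 𝓞 ℚ) ∈ v.asIdeal →
        ρf.HasFrobCharpolyAt v
          ((lPolynomialOfSurface p (af p) (bf p)).reverse.map (Int.castRingHom ℤ_[2])))
    (hcusp : IsParamodularCuspForm 353 2 f) (hne : ∃ Z ∈ siegelUpperHalfSpace 2, f Z ≠ 0)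
    (hfe : ∀ p : ℕ, p.Prime → ¬ p ∣ 353 →
      HasSpinorEulerFactorAt 2 p f ((lPolynomialOfSurface p (af p) (bf p)).map (Int.castRingHom ℂ)))
    (h2 : aA 2 = af 2 ∧ bA 2 = bf 2) :
    IsParamodularAwayFrom A 353 f :=
  paramodular_of_surfaceCertificate hFS hC hframe aA bA af bf hA hρf hcusp hne hfe (fun _ => h2)

/-- The conclusion at one prime `p ≠ 353`: one polynomial is both `L_p(A₃₅₃,T)` and `Q_p(f₃₅₃,T)`. [cite: BrumerEtAl2019, Thm 7.2.1 p. 1189 (shape of the statement)] -/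
theorem eulerFactors_agree_353 {A : AbelianVariety ℚ} {f : Matrix (Fin 2) (Fin 2) ℂ → ℂ}
    (h : IsParamodularAwayFrom A 353 f) {p : ℕ} (hp : p.Prime) (hpN : p ≠ 353) :
    ∃ Q : Polynomial ℚ, HasSpinorEulerFactorAt 2 p f (Q.map (algebraMap ℚ ℂ)) ∧
      A.HasGoodEulerFactorAt p Q :=
  eulerFactors_agree_of_prime (by norm_num) h hp hpN

end Literature.NumberTheory.FaltingsSerre.Paramodular353

end
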